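import Mathlib
import Summits.Ventures.PercRepro2.Defs
import Summits.Ventures.PercRepro2.Graph
import Summits.Ventures.PercRepro2.HullDefs
import Summits.Ventures.PercRepro2.LocRows
import Summits.Ventures.PercRepro2.SwRow
import Summits.Ventures.PercRepro2.SwGlue2

/-!
# A two-vertex cut `{u, v}` with the marks on one side: the cluster structure
(blind cell PercRepro2, night-4 g5, 2026-08-24; proofs/NIGHT4-BRIDGE.md §9)

`G = G₁ ∪ G₂` glued at `{u, v}` (`Glue2.IsGluing2 ends₁ ends₂ u v V₁ V₂`).  For a vertex `x` of the
first side, its cluster in `G` restricted to `V₁` is its cluster in `G₁` PLUS THE VIRTUAL EDGE `{u, v}`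
when `u` and `v` are connected on the second side (`mem_cluster_glue2_add_iff`), and its part on the
second side is the second-side clusters of `u` and `v` that it reaches (`mem_cluster_glue2_side_iff`).
`G₁ + e` (`addEnds`) is `G₁` with one extra edge `{u, v}`; with that edge blue it has the clusters of
`G₁` (`cluster_add_false`).  When `u`, `v` are connected on the second side in both colours, the
first-side part of every cluster is the preimage of a cluster of the MERGED graph `G₁ / {u = v}`
(`mergeEnds`, `v` renamed to `u`; `mem_cluster_glue2_merge_iff`).
-/

namespace Summit.Ventures.PercRepro2

namespace Ear

open Hull LocRows Glue2

open scoped Classical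

variable {V : Type*} {E₁ E₂ : Type*}

/-- `G₁` with the extra edge `{u, v}`. -/
def addEnds (ends₁ : E₁ → Sym2 V) (u v : V) : E₁ ⊕ Unit → Sym2 V :=
  Sum.elim ends₁ (fun _ => s(u, v))

/-- A configuration of `G₁ + e` with the extra edge of colour `c`. -/
def addConfig (ζ₁ : Config E₁) (c : Bool) : Config (E₁ ⊕ Unit) := Sum.elim ζ₁ (fun _ => c)

/-- The first side of `addConfig`. -/
lemma addConfig_inl (ζ₁ : Config E₁) (c : Bool) : addConfig ζ₁ c ∘ Sum.inl = ζ₁ := rfl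

/-- The extra edge of `addConfig`. -/
lemma addConfig_inr (ζ₁ : Config E₁) (c : Bool) : addConfig ζ₁ c (Sum.inr ()) = c := rfl

/-- `addConfig` commutes with the colour swap. -/
lemma addConfig_blue (ζ₁ : Config E₁) (c : Bool) : addConfig (blue ζ₁) (!c) = blue (addConfig ζ₁ c) := by
  funext e; rcases e with e | e <;> rfl

/-- The renaming `v ↦ u`. -/
noncomputable def rename (u v : V) : V → V := fun x => if x = v then u else x

/-- The merged first side `G₁ / {u = v}`: `v` renamed to `u`. -/
noncomputable def mergeEnds (ends₁ : E₁ → Sym2 V) (u v : V) : E₁ → Sym2 V :=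
  fun e => (ends₁ e).map (rename u v)

/-- `rename` identifies exactly `u` and `v`. -/
lemma rename_eq_iff {u v a b : V} :
    rename u v a = rename u v b ↔ a = b ∨ (a = u ∧ b = v) ∨ (a = v ∧ b = u) := by
  unfold rename
  split_ifs with ha hb hb
  · exact ⟨fun _ => Or.inl (ha.trans hb.symm), fun _ => rfl⟩
  · constructor
    · intro h; exact Or.inr (Or.inr ⟨ha, h.symm⟩)
    · rintro (h | ⟨_, h⟩ | ⟨_, h⟩)
      · exact absurd (ha.symm.trans h).symm hb
      · exact absurd h hb
      · exact h.symm
  · constructor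
    · intro h; exact Or.inr (Or.inl ⟨h, hb⟩)
    · rintro (h | ⟨h, _⟩ | ⟨h, _⟩)
      · exact absurd (h.trans hb) ha
      · exact h
      · exact absurd h ha
  · constructor
    · intro h; exact Or.inl h
    · rintro (h | ⟨_, h⟩ | ⟨h, _⟩)
      · exact h
      · exact absurd h hb
      · exact absurd h ha

/-- `rename` fixes the vertices other than `v`. -/
lemma rename_of_ne {u v x : V} (hx : x ≠ v) : rename u v x = x := by simp [rename, hx]

/-- `rename v = u`. -/
lemma rename_v {u v : V} : rename u v v = u := by simp [rename]

/-- `rename u = u`. -/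
lemma rename_u {u v : V} : rename u v u = u := by simp [rename]

variable {ends₁ : E₁ → Sym2 V} {ends₂ : E₂ → Sym2 V} {u v : V} {V₁ V₂ : Set V}

/-- An open adjacency of `G₁ + e` is an adjacency of `G₁` or the extra edge (when red). -/
lemma adj_add_cases {ζ₁ : Config E₁} {c : Bool} {x y : V}
    (hxy : (openGraph (addEnds ends₁ u v) (addConfig ζ₁ c)).Adj x y) :
    (openGraph ends₁ ζ₁).Adj x y ∨ (c = true ∧ s(x, y) = s(u, v)) := by
  obtain ⟨hne, e, he, hends⟩ := openGraph_adj.1 hxy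
  rcases e with e | e
  · exact Or.inl (openGraph_adj.2 ⟨hne, e, he, hends⟩)
  · exact Or.inr ⟨he, by rw [← hends]; rfl⟩

/-- An adjacency of `G₁` is an adjacency of `G₁ + e`. -/
lemma adj_add_of_adj {ζ₁ : Config E₁} {c : Bool} {x y : V} (hxy : (openGraph ends₁ ζ₁).Adj x y) :
    (openGraph (addEnds ends₁ u v) (addConfig ζ₁ c)).Adj x y := by
  obtain ⟨hne, e, he, hends⟩ := openGraph_adj.1 hxy
  exact openGraph_adj.2 ⟨hne, Sum.inl e, he, hends⟩

/-- With the extra edge blue, `G₁ + e` has the clusters of `G₁`. -/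
lemma cluster_add_false (ζ₁ : Config E₁) (x : V) :
    cluster (addEnds ends₁ u v) (addConfig ζ₁ false) x = cluster ends₁ ζ₁ x := by
  apply Set.Subset.antisymm
  · intro y hy
    refine mem_of_conn_of_closed (ends := addEnds ends₁ u v) (ω := addConfig ζ₁ false) ?_
      (mem_cluster_self _ _ _) hy
    intro a ha b hab
    rcases adj_add_cases hab with h | ⟨hc, _⟩
    · exact mem_cluster_of_adj ha h
    · exact absurd hc Bool.false_ne_true
  · intro y hy
    refine mem_of_conn_of_closed (ends := ends₁) (ω := ζ₁) ?_ (mem_cluster_self _ _ _) hy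
    intro a ha b hab
    exact mem_cluster_of_adj ha (adj_add_of_adj hab)

/-- The clusters of `G₁ + e` stay on the first side (for `x ∈ V₁`). -/
lemma cluster_add_subset (hg : IsGluing2 ends₁ ends₂ u v V₁ V₂) {ζ₁ : Config E₁} {c : Bool} {x : V}
    (hx : x ∈ V₁) : cluster (addEnds ends₁ u v) (addConfig ζ₁ c) x ⊆ V₁ := by
  intro y hy
  refine mem_of_conn_of_closed (ends := addEnds ends₁ u v) (ω := addConfig ζ₁ c) ?_ hx hy
  intro a _ b hab
  rcases adj_add_cases hab with h | ⟨_, hs⟩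
  · obtain ⟨_, e, _, hends⟩ := openGraph_adj.1 h
    exact hg.mem₁ e b (by rw [hends]; exact Sym2.mem_mk_right a b)
  · rcases Sym2.eq_iff.1 hs with ⟨_, rfl⟩ | ⟨_, rfl⟩
    · exact hg.h_mem₁
    · exact hg.l_mem₁

/-- The virtual edge is an open adjacency of `G₁ + e` when red. -/
lemma adj_add_uv (huv : u ≠ v) (ζ₁ : Config E₁) :
    (openGraph (addEnds ends₁ u v) (addConfig ζ₁ true)).Adj u v :=
  openGraph_adj.2 ⟨huv, Sum.inr (), rfl, rfl⟩

/-- A connection of `G₁ + e` with the extra edge red iff `u ↔ v` on the second side is a connection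
of the glued graph. -/
lemma conn_glue2_of_conn_add (hg : IsGluing2 ends₁ ends₂ u v V₁ V₂) {ζ : Config (E₁ ⊕ E₂)} {x y : V}
    (h : Conn (addEnds ends₁ u v) (addConfig (ζ ∘ Sum.inl) (decide (Conn ends₂ (ζ ∘ Sum.inr) u v))) x y) :
    Conn (glue2 ends₁ ends₂) ζ x y := by
  have key : y ∈ cluster (glue2 ends₁ ends₂) ζ x := by
    refine mem_of_conn_of_closed (ends := addEnds ends₁ u v)
      (ω := addConfig (ζ ∘ Sum.inl) (decide (Conn ends₂ (ζ ∘ Sum.inr) u v))) ?_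
      (mem_cluster_self _ _ _) h
    intro a ha b hab
    rcases adj_add_cases hab with h₁ | ⟨hc, hs⟩
    · exact mem_cluster_of_adj ha (adj_glue2_iff.2 (Or.inl h₁))
    · have huv : Conn ends₂ (ζ ∘ Sum.inr) u v := decide_eq_true_iff.1 hc
      rcases Sym2.eq_iff.1 hs with ⟨rfl, rfl⟩ | ⟨rfl, rfl⟩
      · exact conn_trans ha (conn_glue2_of_conn₂ huv)
      · exact conn_trans ha (conn_glue2_of_conn₂ (conn_symm huv))
  exact key

/-- **The cluster of a first-side vertex across the cut**: its first-side part is the cluster of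
`G₁ + e` with the extra edge red iff `u ↔ v` on the second side; its second-side part consists of
the second-side clusters of `u` and of `v` when those are reached. -/
theorem cluster_glue2_eq_add (hg : IsGluing2 ends₁ ends₂ u v V₁ V₂) (huv : u ≠ v)
    {ζ : Config (E₁ ⊕ E₂)} {x : V} (hx : x ∈ V₁) :
    cluster (glue2 ends₁ ends₂) ζ x =
      cluster (addEnds ends₁ u v) (addConfig (ζ ∘ Sum.inl) (decide (Conn ends₂ (ζ ∘ Sum.inr) u v))) x ∪
      {y | (u ∈ cluster (addEnds ends₁ u v) (addConfig (ζ ∘ Sum.inl)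
              (decide (Conn ends₂ (ζ ∘ Sum.inr) u v))) x ∧ y ∈ cluster ends₂ (ζ ∘ Sum.inr) u) ∨
           (v ∈ cluster (addEnds ends₁ u v) (addConfig (ζ ∘ Sum.inl)
              (decide (Conn ends₂ (ζ ∘ Sum.inr) u v))) x ∧ y ∈ cluster ends₂ (ζ ∘ Sum.inr) v)} := by
  set c := decide (Conn ends₂ (ζ ∘ Sum.inr) u v) with hc
  set C₁ := cluster (addEnds ends₁ u v) (addConfig (ζ ∘ Sum.inl) c) x with hC₁
  have hcv : v ∈ cluster ends₂ (ζ ∘ Sum.inr) u → c = true := fun h => by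
    rw [hc]; exact decide_eq_true_iff.2 h
  -- the virtual edge joins `u` and `v` in `G₁ + e` when `c = true`
  have hvu : v ∈ cluster ends₂ (ζ ∘ Sum.inr) u → u ∈ C₁ → v ∈ C₁ := fun h hu => by
    have hc' := hcv h
    rw [hC₁, hc'] at hu ⊢
    exact mem_cluster_of_adj hu (adj_add_uv huv _)
  have huv' : v ∈ cluster ends₂ (ζ ∘ Sum.inr) u → v ∈ C₁ → u ∈ C₁ := fun h hv => by
    have hc' := hcv h
    rw [hC₁, hc'] at hv ⊢
    exact mem_cluster_of_adj hv (adj_add_uv huv _).symm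
  apply Set.Subset.antisymm
  · intro y hy
    refine mem_of_conn_of_closed (ends := glue2 ends₁ ends₂) (ω := ζ) ?_
      (Or.inl (mem_cluster_self _ _ _)) hy
    rintro a ha b hab
    rcases adj_glue2_iff.1 hab with h₁ | h₂
    · -- a first-side edge: `a ∈ V₁`, hence `a ∈ C₁`
      have haV₁ : a ∈ V₁ := by
        obtain ⟨_, e, _, hends⟩ := openGraph_adj.1 h₁
        exact hg.mem₁ e a (by rw [hends]; exact Sym2.mem_mk_left a b)
      have ha₁ : a ∈ C₁ := by
        rcases ha with ha | ⟨hu, ha₂⟩ | ⟨hv, ha₂⟩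
        · exact ha
        · have haV₂ : a ∈ V₂ := cluster₂_subset hg hg.l_mem₂ ha₂
          rcases hg.inter a haV₁ haV₂ with rfl | rfl
          · exact hu
          · exact hvu ha₂ hu
        · have haV₂ : a ∈ V₂ := cluster₂_subset hg hg.h_mem₂ ha₂
          rcases hg.inter a haV₁ haV₂ with rfl | rfl
          · exact huv' (mem_cluster_comm'.1 ha₂) hv
          · exact hv
      exact Or.inl (mem_cluster_of_adj ha₁ (adj_add_of_adj h₁))
    · -- a second-side edge: `a ∈ V₂`
      have haV₂ : a ∈ V₂ := by
        obtain ⟨_, e, _, hends⟩ := openGraph_adj.1 h₂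
        exact hg.mem₂ e a (by rw [hends]; exact Sym2.mem_mk_left a b)
      rcases ha with ha | ⟨hu, ha₂⟩ | ⟨hv, ha₂⟩
      · have haV₁ : a ∈ V₁ := cluster_add_subset hg hx ha
        rcases hg.inter a haV₁ haV₂ with rfl | rfl
        · exact Or.inr (Or.inl ⟨ha, mem_cluster_of_adj (mem_cluster_self _ _ _) h₂⟩)
        · exact Or.inr (Or.inr ⟨ha, mem_cluster_of_adj (mem_cluster_self _ _ _) h₂⟩)
      · exact Or.inr (Or.inl ⟨hu, mem_cluster_of_adj ha₂ h₂⟩)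
      · exact Or.inr (Or.inr ⟨hv, mem_cluster_of_adj ha₂ h₂⟩)
  · rintro y (hy | ⟨hu, hy⟩ | ⟨hv, hy⟩)
    · exact conn_glue2_of_conn_add hg hy
    · exact conn_trans (conn_glue2_of_conn_add hg hu) (conn_glue2_of_conn₂ hy)
    · exact conn_trans (conn_glue2_of_conn_add hg hv) (conn_glue2_of_conn₂ hy)

/-- For two first-side vertices, membership in the glued cluster is membership in the `G₁ + e`
cluster. -/
theorem mem_cluster_glue2_add_iff (hg : IsGluing2 ends₁ ends₂ u v V₁ V₂) (huv : u ≠ v)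
    {ζ : Config (E₁ ⊕ E₂)} {x y : V} (hx : x ∈ V₁) (hy : y ∈ V₁) :
    y ∈ cluster (glue2 ends₁ ends₂) ζ x ↔
      y ∈ cluster (addEnds ends₁ u v) (addConfig (ζ ∘ Sum.inl) (decide (Conn ends₂ (ζ ∘ Sum.inr) u v))) x := by
  rw [cluster_glue2_eq_add hg huv hx]
  simp only [Set.mem_union, Set.mem_setOf_eq]
  constructor
  · rintro (h | ⟨hu, hy₂⟩ | ⟨hv, hy₂⟩)
    · exact h
    · have hyV₂ : y ∈ V₂ := cluster₂_subset hg hg.l_mem₂ hy₂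
      rcases hg.inter y hy hyV₂ with rfl | rfl
      · exact hu
      · have hc : decide (Conn ends₂ (ζ ∘ Sum.inr) u y) = true := decide_eq_true_iff.2 hy₂
        rw [hc] at hu ⊢
        exact mem_cluster_of_adj hu (adj_add_uv huv _)
    · have hyV₂ : y ∈ V₂ := cluster₂_subset hg hg.h_mem₂ hy₂
      rcases hg.inter y hy hyV₂ with rfl | rfl
      · have hc : decide (Conn ends₂ (ζ ∘ Sum.inr) y v) = true :=
          decide_eq_true_iff.2 (mem_cluster_comm'.1 hy₂)
        rw [hc] at hv ⊢
        exact mem_cluster_of_adj hv (adj_add_uv huv _).symm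
      · exact hv
  · exact Or.inl

/-! ## The merged first side: `G₁ + e` with the extra edge red has the clusters of `G₁ / {u = v}` -/

/-- `u ∈ C(v) ↔ v ∈ C(u)`. -/
lemma mem_cluster_comm_ear {E : Type*} {ends : E → Sym2 V} {ω : Config E} {a b : V} :
    a ∈ cluster ends ω b ↔ b ∈ cluster ends ω a := by
  simp only [mem_cluster]; exact ⟨conn_symm, conn_symm⟩

/-- A red edge of `G₁` gives a red adjacency of the merged graph between the renamed ends. -/
lemma adj_merge_of_edge {ζ₁ : Config E₁} {f : E₁} (hf : ζ₁ f = true) {a b : V}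
    (hends : ends₁ f = s(a, b)) (hne : rename u v a ≠ rename u v b) :
    (openGraph (mergeEnds ends₁ u v) ζ₁).Adj (rename u v a) (rename u v b) := by
  refine openGraph_adj.2 ⟨hne, f, hf, ?_⟩
  show (ends₁ f).map (rename u v) = s(rename u v a, rename u v b)
  rw [hends, Sym2.map_mk]

/-- **The merged clusters**: with the extra edge red, the clusters of `G₁ + e` are the preimages of
the clusters of the merged graph under the renaming. -/
theorem mem_cluster_add_true_iff_merge (huv : u ≠ v) {ζ₁ : Config E₁} (x y : V) :
    y ∈ cluster (addEnds ends₁ u v) (addConfig ζ₁ true) x ↔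
      rename u v y ∈ cluster (mergeEnds ends₁ u v) ζ₁ (rename u v x) := by
  have huv' : v ∈ cluster (addEnds ends₁ u v) (addConfig ζ₁ true) u :=
    mem_cluster_of_adj (mem_cluster_self _ _ _) (adj_add_uv huv ζ₁)
  -- vertices with the same name are in the same cluster of `G₁ + e`
  have hsame : ∀ a b : V, rename u v a = rename u v b →
      b ∈ cluster (addEnds ends₁ u v) (addConfig ζ₁ true) a := by
    intro a b hab
    rcases rename_eq_iff.1 hab with h | ⟨rfl, rfl⟩ | ⟨rfl, rfl⟩
    · rw [h]; exact mem_cluster_self _ _ _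
    · exact huv'
    · exact mem_cluster_comm_ear.1 huv'
  constructor
  · intro hy
    refine mem_of_conn_of_closed (ends := addEnds ends₁ u v) (ω := addConfig ζ₁ true)
      (S := {y | rename u v y ∈ cluster (mergeEnds ends₁ u v) ζ₁ (rename u v x)})
      ?_ (mem_cluster_self _ _ _) hy
    intro a ha b hab
    simp only [Set.mem_setOf_eq] at ha ⊢
    rcases adj_add_cases hab with h | ⟨_, hs⟩
    · obtain ⟨_, f, hf, hends⟩ := openGraph_adj.1 h
      by_cases hne : rename u v a = rename u v b
      · rw [← hne]; exact ha
      · exact mem_cluster_of_adj ha (adj_merge_of_edge hf hends hne)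
    · have : rename u v a = rename u v b := by
        rcases Sym2.eq_iff.1 hs with ⟨rfl, rfl⟩ | ⟨rfl, rfl⟩
        · rw [rename_u, rename_v]
        · rw [rename_u, rename_v]
      rw [← this]; exact ha
  · intro hy
    have key : cluster (mergeEnds ends₁ u v) ζ₁ (rename u v x) ⊆
        {z | ∃ y', z = rename u v y' ∧ y' ∈ cluster (addEnds ends₁ u v) (addConfig ζ₁ true) x} := by
      intro z hz
      refine mem_of_conn_of_closed (ends := mergeEnds ends₁ u v) (ω := ζ₁) ?_
        ⟨x, rfl, mem_cluster_self _ _ _⟩ hz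
      rintro a ⟨a', rfl, ha'⟩ b hab
      obtain ⟨_, f, hf, hends⟩ := openGraph_adj.1 hab
      obtain ⟨c, d, hcd⟩ : ∃ c d, ends₁ f = s(c, d) := by
        induction ends₁ f using Sym2.ind with
        | _ c d => exact ⟨c, d, rfl⟩
      have hmap : s(rename u v c, rename u v d) = s(rename u v a', b) := by
        rw [← Sym2.map_mk, ← hcd]; exact hends
      have hcl : ∀ c', rename u v c' = rename u v a' →
          c' ∈ cluster (addEnds ends₁ u v) (addConfig ζ₁ true) x := fun c' hc' =>
        mem_of_conn_of_closed (ends := addEnds ends₁ u v) (ω := addConfig ζ₁ true)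
          (S := cluster (addEnds ends₁ u v) (addConfig ζ₁ true) x)
          (fun p hp q hpq => mem_cluster_of_adj hp hpq) ha' (hsame a' c' hc'.symm)
      rcases Sym2.eq_iff.1 hmap with ⟨hca, hdb⟩ | ⟨hcb, hda⟩
      · exact ⟨d, hdb.symm, mem_cluster_of_edge (ends := addEnds ends₁ u v) (hcl c hca) (e := Sum.inl f)
          hf hcd⟩
      · exact ⟨c, hcb.symm, mem_cluster_of_edge (ends := addEnds ends₁ u v) (hcl d hda) (e := Sum.inl f)
          hf (by show ends₁ f = s(d, c); rw [hcd, Sym2.eq_swap])⟩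
    obtain ⟨y', hy', hy'x⟩ := key hy
    exact mem_of_conn_of_closed (ends := addEnds ends₁ u v) (ω := addConfig ζ₁ true)
      (S := cluster (addEnds ends₁ u v) (addConfig ζ₁ true) x)
      (fun p hp q hpq => mem_cluster_of_adj hp hpq) hy'x (hsame y' y hy'.symm)

/-! ## `Q` of the glued graph by the class of the second side -/

variable [Fintype E₁] [DecidableEq E₁] [Fintype E₂] [DecidableEq E₂]

/-- The two hull conditions and the two side conditions of `Q`, in terms of `G₁ + e` with the red
virtual edge present iff `u ↔_R v` on the second side and the blue one iff `u ↔_B v`. -/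
theorem mem_tgtU_glue2_iff_add (hg : IsGluing2 ends₁ ends₂ u v V₁ V₂) (huv : u ≠ v) {l h o : V}
    (hl : l ∈ V₁) (hh : h ∈ V₁) (ho : o ∈ V₁) {ζ : Config (E₁ ⊕ E₂)} :
    ζ ∈ tgtU (glue2 ends₁ ends₂) l h {S : Set V | o ∈ S} ↔
      (h ∉ cluster (addEnds ends₁ u v)
          (addConfig (ζ ∘ Sum.inl) (decide (Conn ends₂ (ζ ∘ Sum.inr) u v))) l ∧
        h ∉ cluster (addEnds ends₁ u v)
          (addConfig (blue (ζ ∘ Sum.inl)) (decide (Conn ends₂ (blue (ζ ∘ Sum.inr)) u v))) l) ∧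
      o ∈ cluster (addEnds ends₁ u v)
          (addConfig (ζ ∘ Sum.inl) (decide (Conn ends₂ (ζ ∘ Sum.inr) u v))) l ∧
      o ∉ cluster (addEnds ends₁ u v)
          (addConfig (blue (ζ ∘ Sum.inl)) (decide (Conn ends₂ (blue (ζ ∘ Sum.inr)) u v))) l := by
  simp only [tgtU, Finset.mem_filter, Finset.mem_univ, true_and, hull, Set.mem_union,
    Set.mem_setOf_eq, not_or]
  rw [mem_cluster_glue2_add_iff hg huv hl hh, mem_cluster_glue2_add_iff hg huv hl ho,
    mem_cluster_glue2_add_iff hg huv hl hh (ζ := blue ζ), mem_cluster_glue2_add_iff hg huv hl ho (ζ := blue ζ),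
    blue_comp_inl, blue_comp_inr]

/-- **Class `(c, !c)`** (`u ↔ v` on the second side in exactly one colour): `Q(G)` is `Q(G₁ + e)` with
the extra edge of that colour. -/
theorem mem_tgtU_glue2_iff_mixed (hg : IsGluing2 ends₁ ends₂ u v V₁ V₂) (huv : u ≠ v) {l h o : V}
    (hl : l ∈ V₁) (hh : h ∈ V₁) (ho : o ∈ V₁) {ζ : Config (E₁ ⊕ E₂)} {c : Bool}
    (hr : decide (Conn ends₂ (ζ ∘ Sum.inr) u v) = c)
    (hb : decide (Conn ends₂ (blue (ζ ∘ Sum.inr)) u v) = !c) :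
    ζ ∈ tgtU (glue2 ends₁ ends₂) l h {S : Set V | o ∈ S} ↔
      addConfig (ζ ∘ Sum.inl) c ∈ tgtU (addEnds ends₁ u v) l h {S : Set V | o ∈ S} := by
  rw [mem_tgtU_glue2_iff_add hg huv hl hh ho, hr, hb]
  simp only [tgtU, Finset.mem_filter, Finset.mem_univ, true_and, hull, Set.mem_union,
    Set.mem_setOf_eq, not_or, ← addConfig_blue]

/-- **Class `(false, false)`** (`u ↮ v` on the second side in both colours): `Q(G)` is `Q(G₁)`. -/
theorem mem_tgtU_glue2_iff_none (hg : IsGluing2 ends₁ ends₂ u v V₁ V₂) (huv : u ≠ v) {l h o : V}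
    (hl : l ∈ V₁) (hh : h ∈ V₁) (ho : o ∈ V₁) {ζ : Config (E₁ ⊕ E₂)}
    (hr : decide (Conn ends₂ (ζ ∘ Sum.inr) u v) = false)
    (hb : decide (Conn ends₂ (blue (ζ ∘ Sum.inr)) u v) = false) :
    ζ ∈ tgtU (glue2 ends₁ ends₂) l h {S : Set V | o ∈ S} ↔
      (ζ ∘ Sum.inl) ∈ tgtU ends₁ l h {S : Set V | o ∈ S} := by
  rw [mem_tgtU_glue2_iff_add hg huv hl hh ho, hr, hb, cluster_add_false, cluster_add_false]
  simp only [tgtU, Finset.mem_filter, Finset.mem_univ, true_and, hull, Set.mem_union,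
    Set.mem_setOf_eq, not_or]

/-- **Class `(true, true)`** (`u ↔ v` on the second side in both colours): `Q(G)` is `Q` of the merged
first side (the marks are fixed by the renaming). -/
theorem mem_tgtU_glue2_iff_merge (hg : IsGluing2 ends₁ ends₂ u v V₁ V₂) (huv : u ≠ v) {l h o : V}
    (hl : l ∈ V₁) (hh : h ∈ V₁) (ho : o ∈ V₁) (hlv : l ≠ v) (hhv : h ≠ v) (hov : o ≠ v)
    {ζ : Config (E₁ ⊕ E₂)}
    (hr : decide (Conn ends₂ (ζ ∘ Sum.inr) u v) = true)
    (hb : decide (Conn ends₂ (blue (ζ ∘ Sum.inr)) u v) = true) :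
    ζ ∈ tgtU (glue2 ends₁ ends₂) l h {S : Set V | o ∈ S} ↔
      (ζ ∘ Sum.inl) ∈ tgtU (mergeEnds ends₁ u v) l h {S : Set V | o ∈ S} := by
  rw [mem_tgtU_glue2_iff_add hg huv hl hh ho, hr, hb]
  simp only [tgtU, Finset.mem_filter, Finset.mem_univ, true_and, hull, Set.mem_union,
    Set.mem_setOf_eq, not_or]
  rw [mem_cluster_add_true_iff_merge huv, mem_cluster_add_true_iff_merge huv,
    mem_cluster_add_true_iff_merge huv, mem_cluster_add_true_iff_merge huv,
    rename_of_ne hlv, rename_of_ne hhv, rename_of_ne hov]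

end Ear

end Summit.Ventures.PercRepro2
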